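import Summits.BirchSwinnertonDyer.Rank1Residual.ManinAdditive.ConwayCut
import HarnessLib

/-!
# The lattice bookkeeping of desc's `ConwayDepthTransfer`: full Conway depth on the `f`-line ⟹ Néron congruence depth

Summit `BirchSwinnertonDyer`, route `ManinLocalTwoThree` (cell bsd-f2-manin), deciding crux C2 `ManinOddAtFour`
(stmt-BirchSwinnertonDyer-22967); descent / visibility lens (planner `bsd-f2-manin-desc` g5, MEMO-desc §22; typed leaf
`…ManinAdditive.ConwayCut`, support row `ConwayDepthTransfer`, refuter-1 §R53 P7: «TRUE on paper at 4 ∣ N … so a prover lands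
it»).  The row reads: for a Néron `f`-line datum `Δ` with `Λ` equal to the Conway-stable lattice `S^G` up to ODD index
(`IsConwayNeronAtTwo Δ`), if the `f`-line index `[e_f S^G : ℤ f]` is finite with `2`-adic valuation `ord₂ deg φ`, then
`Δ` has Néron congruence depth at `2` (`NeronCongruenceDepthAt 2`: some Néron differential has `f`-coordinate of
`2`-valuation `−ord₂ deg φ`), whence `2 ∤ c_E` (`not_two_dvd_maninConstant_of_conwayDepth`, landed by desc).

THIS FILE proves the row's LATTICE CONTENT unconditionally, under the one hypothesis that carries the modular-form
input, `D.f ∈ S^G` (for `4 ∣ N` this is `t f = −f` from `a₂ = 0` and `w_{Q_p} f = ±f`, Atkin–Lehner; refuter-1's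
`span_le_conwayStableLattice` takes exactly these eigen-facts as hypotheses, the tree does not yet compute the
`q`-expansion action of `halfTranslate`):

* `conwayDepthTransfer_of_mem` — `D.f ∈ S^G`, `IsConwayNeronAtTwo Δ`, `ord₂ [e_f S^G : ℤf] = ord₂ deg φ`,
  `[e_f S^G : ℤf] ≠ 0` ⟹ `Δ.NeronCongruenceDepthAt 2`;
* `conwayDepthTransfer_of_newform_mem` — `ConwayDepthTransfer` itself, GIVEN «the newform of every datum at a level
  `4 ∣ N` lies in `S^G`» as an explicit hypothesis.

PROOF (finite subgroups of `ℚ/ℤ` are cyclic).  Put `M = S^G`, `θ = ⟨f, ·⟩`, `c₀ = ⟨f, f⟩ ≠ 0`, `K = ℤf + (M ∩ f^⊥)`,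
`r = #(M/K)`.  Since `f ∈ M`: `m ∈ K ⟺ θ(m) ∈ ℤc₀`.  `r` kills `M/K`, so `θ(r m) = n_m c₀` with `n_m ∈ ℤ`, and
`m ↦ n_m (mod r)` is an INJECTIVE hom `M/K ↪ ℤ/r`, hence bijective (both have `r` elements): some `m₀ ∈ M` has
`θ(m₀) = c₀/r`.  An odd multiple `n m₀` lies in `Λ` (`IsConwayNeronAtTwo`), and its `f`-coordinate `n/r` has
`2`-valuation `−ord₂ r = −ord₂ deg φ`.  No definitions; nothing about BSD, Manin's conjecture or any Manin constant.
-/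

set_option autoImplicit false
set_option linter.dupNamespace false

noncomputable section

open scoped Classical MatrixGroups ModularForm
open CongruenceSubgroup Literature.NumberTheory.EllipticCurves.ModularForms
open Summit.BirchSwinnertonDyer.Rank1Residual.ManinAdditive
  Summit.BirchSwinnertonDyer.Rank1Residual.ManinAdditive.ConwayCut

namespace Summit.BirchSwinnertonDyer.BirchSwinnertonDyer.Theorems.ManinLocalTwoThree

variable {N : ℕ} [NeZero N] {W : WeierstrassCurve ℚ} [W.IsElliptic] {D : ModularParametrizationData W N}

/-- **Exact `f`-coordinate `1/r` in a lattice of finite `f`-line index `r`.**  For a `ℤ`-lattice `M` of cusp forms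
containing `f`, with `⟨f, f⟩ ≠ 0` and `f`-line index `r = [e_f M : ℤ f] ≠ 0` (the tree's `lineIndex`), some `m₀ ∈ M`
has `r · ⟨f, m₀⟩ = ⟨f, f⟩`.  (The `f`-coordinates `⟨f, m⟩/⟨f, f⟩`, `m ∈ M`, form a subgroup of `(1/r)ℤ` mapping
`M/K` injectively, hence bijectively, onto `ℤ/r`.) [folklore] -/
theorem exists_mem_petersson_eq_of_lineIndex_ne_zero (M : Submodule ℤ (CuspForm (Gamma0 N) 2))
    (f : CuspForm (Gamma0 N) 2) (hf : f ∈ M) (hc₀ : peterssonProduct (Gamma0 N) 2 f f ≠ 0)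
    (hr : lineIndex M f ≠ 0) :
    ∃ m₀ ∈ M, (lineIndex M f : ℂ) * peterssonProduct (Gamma0 N) 2 f m₀ = peterssonProduct (Gamma0 N) 2 f f := by
  set θ := peterssonProductₗ (Gamma0 N) 2 f with hθ
  set c₀ := peterssonProduct (Gamma0 N) 2 f f with hc₀def
  set K : Submodule ℤ M := ((ℤ ∙ f) ⊔ (M ⊓ (LinearMap.ker θ).restrictScalars ℤ)).comap M.subtype with hK
  set r := lineIndex M f with hrdef
  have hrK : r = Nat.card (M ⧸ K) := rfl
  haveI hfin : Finite (M ⧸ K) := Nat.finite_of_card_ne_zero (hrK ▸ hr)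
  haveI : NeZero r := ⟨hr⟩
  have hθf : θ f = c₀ := by rw [hθ, peterssonProductₗ_apply]
  -- `m ∈ K ⟺ θ m ∈ ℤ c₀`
  have memK : ∀ m : M, m ∈ K ↔ ∃ n : ℤ, θ (m : CuspForm (Gamma0 N) 2) = n * c₀ := by
    intro m
    constructor
    · intro hm
      rw [hK, Submodule.mem_comap, Submodule.subtype_apply, Submodule.mem_sup] at hm
      obtain ⟨y, hy, z, hz, hyz⟩ := hm
      obtain ⟨n, rfl⟩ := Submodule.mem_span_singleton.mp hy
      refine ⟨n, ?_⟩
      have hz0 : θ z = 0 := by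
        have := (Submodule.mem_inf.mp hz).2
        rwa [Submodule.restrictScalars_mem, LinearMap.mem_ker] at this
      rw [← hyz, map_add, map_zsmul, hz0, add_zero, zsmul_eq_mul, hθf]
    · rintro ⟨n, hn⟩
      rw [hK, Submodule.mem_comap, Submodule.subtype_apply, Submodule.mem_sup]
      refine ⟨n • f, Submodule.mem_span_singleton.mpr ⟨n, rfl⟩, (m : CuspForm (Gamma0 N) 2) - n • f, ?_, by abel⟩
      refine Submodule.mem_inf.mpr ⟨M.sub_mem m.2 (M.smul_mem n hf), ?_⟩
      rw [Submodule.restrictScalars_mem, LinearMap.mem_ker, map_sub, map_zsmul, hn, zsmul_eq_mul, hθf, sub_self]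
  -- `r` kills `M/K`: `θ (r m) = n_m c₀`
  have hkill : ∀ m : M, ∃ n : ℤ, θ ((r • m : M) : CuspForm (Gamma0 N) 2) = n * c₀ := by
    intro m
    apply (memK _).mp
    rw [← Submodule.Quotient.mk_eq_zero, Submodule.Quotient.mk_smul, hrK]
    exact card_nsmul_eq_zero'
  choose g₀ hg₀ using hkill
  have hθr : ∀ m : M, θ ((r • m : M) : CuspForm (Gamma0 N) 2) = (r : ℂ) * θ m := by
    intro m; rw [Submodule.coe_smul_of_tower, map_nsmul, nsmul_eq_mul]
  -- uniqueness of the integer `n_m`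
  have huniq : ∀ {a b : ℤ}, (a : ℂ) * c₀ = b * c₀ → a = b := fun {a b} h =>
    by exact_mod_cast mul_right_cancel₀ hc₀ h
  have hadd : ∀ m m' : M, g₀ (m + m') = g₀ m + g₀ m' := by
    intro m m'
    apply huniq
    rw [← hg₀, Int.cast_add, add_mul, ← hg₀, ← hg₀, hθr, hθr, hθr, Submodule.coe_add, map_add, mul_add]
  have hKdvd : ∀ m : M, m ∈ K ↔ (r : ℤ) ∣ g₀ m := by
    intro m
    rw [memK]
    constructor
    · rintro ⟨n, hn⟩
      refine ⟨n, huniq ?_⟩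
      rw [← hg₀, hθr, hn]; push_cast; ring
    · rintro ⟨n, hn⟩
      refine ⟨n, ?_⟩
      have h := hg₀ m
      rw [hθr, hn] at h
      push_cast at h
      have hrC : (r : ℂ) ≠ 0 := by exact_mod_cast hr
      exact mul_left_cancel₀ hrC (by rw [h]; ring)
  -- the hom `M → ℤ/r`
  let G₀ : M →+ ℤ := AddMonoidHom.mk' g₀ hadd
  let G : M →ₗ[ℤ] ZMod r := ((Int.castAddHom (ZMod r)).comp G₀).toIntLinearMap
  have hGapply : ∀ m : M, G m = ((g₀ m : ℤ) : ZMod r) := fun _ => rfl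
  have hKle : K ≤ LinearMap.ker G := by
    intro m hm
    rw [LinearMap.mem_ker, hGapply, ZMod.intCast_zmod_eq_zero_iff_dvd]
    exact (hKdvd m).mp hm
  set Gbar := K.liftQ G hKle with hGbar
  have hinj : Function.Injective Gbar := by
    intro x y hxy
    obtain ⟨m, rfl⟩ := Submodule.Quotient.mk_surjective K x
    obtain ⟨m', rfl⟩ := Submodule.Quotient.mk_surjective K y
    rw [Submodule.Quotient.eq]
    rw [hGbar, Submodule.liftQ_apply, Submodule.liftQ_apply, hGapply, hGapply,
      ZMod.intCast_eq_intCast_iff_dvd_sub] at hxy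
    have hsub : g₀ (m - m') = g₀ m - g₀ m' := map_sub G₀ m m'
    rw [hKdvd, hsub]
    obtain ⟨t, ht⟩ := hxy
    exact ⟨-t, by linarith⟩
  have hbij : Function.Bijective Gbar :=
    hinj.bijective_of_nat_card_le (by rw [Nat.card_zmod, ← hrK])
  obtain ⟨x, hx⟩ := hbij.2 1
  obtain ⟨m, rfl⟩ := Submodule.Quotient.mk_surjective K x
  rw [hGbar, Submodule.liftQ_apply, hGapply] at hx
  -- `g₀ m ≡ 1 (mod r)`: correct by a multiple of `f`
  have h1 : ((g₀ m - 1 : ℤ) : ZMod r) = 0 := by push_cast; rw [hx, sub_self]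
  obtain ⟨t, ht⟩ := (ZMod.intCast_zmod_eq_zero_iff_dvd _ r).mp h1
  refine ⟨(m : CuspForm (Gamma0 N) 2) - (t : ℤ) • f, M.sub_mem m.2 (M.smul_mem t hf), ?_⟩
  have key := hg₀ m
  rw [hθr] at key
  have hθf : θ f = c₀ := by rw [hθ, peterssonProductₗ_apply]
  have e : θ ((m : CuspForm (Gamma0 N) 2) - (t : ℤ) • f) = θ m - (t : ℂ) * c₀ := by
    rw [map_sub, map_zsmul, hθf, zsmul_eq_mul]
  change (r : ℂ) * θ ((m : CuspForm (Gamma0 N) 2) - (t : ℤ) • f) = c₀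
  rw [e, mul_sub, key, show (g₀ m : ℂ) = 1 + r * t by exact_mod_cast (by linarith : g₀ m = 1 + r * t)]
  ring

/-- **The lattice content of desc's `ConwayDepthTransfer` (MEMO-desc §22), PROVED given `f ∈ S^G`.**  For a Néron
`f`-line datum `Δ` with the newform `D.f` in the Conway-stable lattice `S^G`, the GIVEN row `IsConwayNeronAtTwo Δ`
(`Λ ≤ S^G`, every element of `S^G` has an odd multiple in `Λ`), finite `f`-line index `[e_f S^G : ℤf]` and full depth
`ord₂ [e_f S^G : ℤf] = ord₂ deg φ`, the datum has Néron congruence depth at `2`; hence (desc, landed)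
`2 ∤ c_E` and Lie saturation at `2`.  The hypothesis `D.f ∈ S^G` holds at `4 ∣ N` by `t f = −f` (`a₂ = 0`) and
`w_Q f = ±f` (Atkin–Lehner), cf. `ConwayRamanujanCutEdges.span_le_conwayStableLattice`.
[cite: AgasheRibetStein2012, §2.1 (shape only: congruence number as an `f`-line index; the Conway-lattice row is the cell's, MEMO-desc §22)] -/
theorem conwayDepthTransfer_of_mem (Δ : NeronFLineDatum W D) (hfM : D.f ∈ conwayStableLattice N)
    (hΛ : IsConwayNeronAtTwo Δ)
    (hv : padicValNat 2 (lineIndex (conwayStableLattice N) D.f) = padicValNat 2 D.modularDegree)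
    (hr : lineIndex (conwayStableLattice N) D.f ≠ 0) : Δ.NeronCongruenceDepthAt 2 := by
  obtain ⟨m₀, hm₀, hθ⟩ := exists_mem_petersson_eq_of_lineIndex_ne_zero (conwayStableLattice N) D.f hfM
    Δ.petersson_self_ne_zero hr
  obtain ⟨n, hn, hnm⟩ := hΛ.2 m₀ hm₀
  set r := lineIndex (conwayStableLattice N) D.f with hrdef
  refine ⟨⟨(n : ℤ) • m₀, hnm⟩, (n : ℚ) / r, div_ne_zero (by exact_mod_cast hn.pos.ne') (by exact_mod_cast hr), ?_, ?_⟩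
  · have hrC : (r : ℂ) ≠ 0 := by exact_mod_cast hr
    change (((n : ℚ) / r : ℚ) : ℂ) * peterssonProduct (Gamma0 N) 2 D.f D.f =
      peterssonProduct (Gamma0 N) 2 D.f ((n : ℤ) • m₀)
    rw [← peterssonProductₗ_apply D.f ((n : ℤ) • m₀), map_zsmul, peterssonProductₗ_apply, zsmul_eq_mul,
      ← hθ]
    push_cast
    field_simp
  · have hn2 : ¬ 2 ∣ n := hn.not_two_dvd_nat
    rw [padicValRat.div (by exact_mod_cast hn.pos.ne') (by exact_mod_cast hr), ← hv, padicValRat.of_nat, padicValRat.of_nat,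
      padicValNat.eq_zero_of_not_dvd hn2]
    simp

/-- **`ConwayDepthTransfer` GIVEN the newform membership `D.f ∈ S^G` at every level `4 ∣ N`** (the `q`-expansion facts
`t f = −f`, `w_Q f = ±f`, passed as one explicit hypothesis; nothing else is assumed). -/
theorem conwayDepthTransfer_of_newform_mem
    (hmem : ∀ (N : ℕ) [NeZero N] (W : WeierstrassCurve ℚ) [W.IsElliptic] (D : ModularParametrizationData W N),
      4 ∣ N → D.f ∈ conwayStableLattice N) :
    ConwayDepthTransfer := by
  intro N _ W _ D Δ h4 hΛ hv hr
  exact conwayDepthTransfer_of_mem Δ (hmem N W D h4) hΛ hv hr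

end Summit.BirchSwinnertonDyer.BirchSwinnertonDyer.Theorems.ManinLocalTwoThree

end
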